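import Summits.QuantumFields.YangMills.Theorems.AllWindowsColdBoxGaussDCoordinateProcess
import Summits.QuantumFields.YangMills.Theorems.AllWindowsColdBoxTiltDominators
import Mathlib.Algebra.Order.Chebyshev
import HarnessLib

/-!
# LINE-17 «hypercontractive second-order tilt expansion» on crux `AllWindowsColdBox.BoxMidWindowsSU22` (stmt-QuantumFields-24003):
# Wick moments of the dominators `Σ_e ‖a_e‖²`, `Σ_e ‖a_e‖⁴` (STUB-PLAN-E §2 E(4): `E Q₂ ≤ K H⁵`, `(E Q₄²)^{1/2} ≤ K H⁶`)

Continuation of `…AllWindowsColdBoxTiltDominators` (the dominators of the tilt as explicit polynomials of the Gaussian coordinates,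
`a_e = unscaleTE H D β t e`, `Σ_e‖a_e‖² = Q₂/β`, `Σ_e‖a_e‖⁴ = Q₄/β²`, `Q₂ = Σ_eΣ_a (t a)_e²`, `Q₄ = Σ_e(Σ_a (t a)_e²)²`) with the numerical
values of their first two moments under `γ = gaussD H D`, from the even coordinate moments `E[(t a)_e^{2k}] ≤ (2k−1)!!·(16H)^k`
(`…AllWindowsColdBoxGaussDCoordinateProcess.integral_coord_pow_even_gaussD_le`, `H ≥ 1`) and the power-mean inequality
(`pow_sum_le_card_mul_sum_pow`; no eight-fold Wick sums):

* §1 pointwise: `(Σ_aY²)^{m+1} ≤ D^m Σ_a Y^{2(m+1)}`, `Q₂^{m+1} ≤ (#E_f·D)^m ΣΣ Y^{2(m+1)}`, `Q₄^{m+1} ≤ #E_f^m D^{2m+1} ΣΣ Y^{4(m+1)}`;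
* §2 ALL POWERS of `Q₂`, `Q₄` are `γ`-integrable; `E Q₂ ≤ D·#E_f·16H`, `E Q₂² ≤ 3D²#E_f²(16H)²`, `E Q₄ ≤ 3D²#E_f(16H)²`,
  `E Q₄² ≤ 105·D⁴#E_f²(16H)⁴` (`#E_f = Fintype.card (DirFree H) = Fintype.card (ColdFreeIdx H)`);
* §3 the same for `c·Σ_e‖a_e‖²` and `c·Σ_e‖a_e‖⁴` (`β > 0`): integrability of all powers (hypothesis `hint` of
  `CappedExpMoment.setIntegral_exp_mul_abs_le_of_moments`) and the second moments `s₃ ≤ c²·3D²#E_f²(16H)²/β²`,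
  `s₂ ≤ c²·105D⁴#E_f²(16H)⁴/β⁴` (its `s`), i.e. `σ₂ ≍ H⁶/β`, `σ₃ ≍ H⁵/β` as in STUB-PLAN-E §2 E(4)–E(5).

No definition; standard axioms.  HONEST LABEL: helper lemmas toward the OPEN registered stub E `stub_tiltMoments` of one critic-PASSed line on the
R2ξ″ RECORD-rung crux 24003; no stub is proved by name, no crux, rung or summit is proved; the Yang–Mills mass gap is NOT proved by this file.
-/

set_option autoImplicit false

noncomputable section

open MeasureTheory ProbabilityTheory Finset
open Literature.MathematicalPhysics.QuantumLattice
open Literature.MathematicalPhysics.QuantumFieldTheory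
open Literature.MathematicalPhysics.QuantumFieldTheory.LatticeMaxwell
open Summit.QuantumFields.YangMills.Theorems.WeakCouplingRates
open Summit.QuantumFields.YangMills.Theorems.ColdBoxAllGroups

namespace Summit.QuantumFields.YangMills.Theorems.AllWindowsColdBoxBoxMidLine

/-! ## §1 Pointwise power-mean bounds for the coordinate polynomials `Q₂ = Σ_eΣ_a Y²`, `Q₄ = Σ_e(Σ_a Y²)²` -/

section Pointwise

variable {H D : ℕ}

/-- `#(DirFree H) = #(ColdFreeIdx H)` (the tree's `dirFreeEquiv`). -/
theorem card_dirFree_eq_card_coldFreeIdx : Fintype.card (DirFree H) = Fintype.card (ColdFreeIdx H) :=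
  Fintype.card_congr (dirFreeEquiv H)

/-- Power mean for the inner colour sum: `(Σ_a Y_{ae}²)^{m+1} ≤ D^m · Σ_a Y_{ae}^{2(m+1)}`. -/
theorem colourSum_sq_pow_le (t : TSpaceD H D) (e : DirFree H) (m : ℕ) :
    (∑ a : Fin D, WithLp.ofLp (t a) e ^ 2) ^ (m + 1) ≤ (D : ℝ) ^ m * ∑ a : Fin D, WithLp.ofLp (t a) e ^ (2 * (m + 1)) := by
  have h := pow_sum_le_card_mul_sum_pow (s := (Finset.univ : Finset (Fin D))) (f := fun a => WithLp.ofLp (t a) e ^ 2)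
    (fun a _ => sq_nonneg _) m
  simp only [Finset.card_univ, Fintype.card_fin, ← pow_mul] at h
  exact_mod_cast h

/-- Power mean for `Q₂`: `(Σ_eΣ_a Y²)^{m+1} ≤ (#E_f·D)^m · Σ_eΣ_a Y^{2(m+1)}`. -/
theorem quadDom_pow_le (t : TSpaceD H D) (m : ℕ) :
    (∑ e : DirFree H, ∑ a : Fin D, WithLp.ofLp (t a) e ^ 2) ^ (m + 1) ≤
      ((Fintype.card (DirFree H) : ℝ) * D) ^ m * ∑ e : DirFree H, ∑ a : Fin D, WithLp.ofLp (t a) e ^ (2 * (m + 1)) := by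
  have h1 := pow_sum_le_card_mul_sum_pow (s := (Finset.univ : Finset (DirFree H)))
    (f := fun e => ∑ a : Fin D, WithLp.ofLp (t a) e ^ 2) (fun e _ => Finset.sum_nonneg fun a _ => sq_nonneg _) m
  simp only [Finset.card_univ] at h1
  have h2 : ∑ e : DirFree H, (∑ a : Fin D, WithLp.ofLp (t a) e ^ 2) ^ (m + 1) ≤
      ∑ e : DirFree H, (D : ℝ) ^ m * ∑ a : Fin D, WithLp.ofLp (t a) e ^ (2 * (m + 1)) :=
    Finset.sum_le_sum fun e _ => colourSum_sq_pow_le t e m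
  rw [← Finset.mul_sum] at h2
  calc _ ≤ (Fintype.card (DirFree H) : ℝ) ^ m * ∑ e : DirFree H, (∑ a : Fin D, WithLp.ofLp (t a) e ^ 2) ^ (m + 1) := by
        exact_mod_cast h1
    _ ≤ (Fintype.card (DirFree H) : ℝ) ^ m * ((D : ℝ) ^ m * ∑ e : DirFree H, ∑ a : Fin D, WithLp.ofLp (t a) e ^ (2 * (m + 1))) :=
        mul_le_mul_of_nonneg_left h2 (by positivity)
    _ = _ := by rw [mul_pow]; ring

/-- Power mean for `Q₄`: `(Σ_e(Σ_a Y²)²)^{m+1} ≤ #E_f^m · D^{2m+1} · Σ_eΣ_a Y^{4(m+1)}`. -/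
theorem quartDom_pow_le (t : TSpaceD H D) (m : ℕ) :
    (∑ e : DirFree H, (∑ a : Fin D, WithLp.ofLp (t a) e ^ 2) ^ 2) ^ (m + 1) ≤
      (Fintype.card (DirFree H) : ℝ) ^ m * (D : ℝ) ^ (2 * m + 1) *
        ∑ e : DirFree H, ∑ a : Fin D, WithLp.ofLp (t a) e ^ (4 * (m + 1)) := by
  have h1 := pow_sum_le_card_mul_sum_pow (s := (Finset.univ : Finset (DirFree H)))
    (f := fun e => (∑ a : Fin D, WithLp.ofLp (t a) e ^ 2) ^ 2) (fun e _ => sq_nonneg _) m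
  simp only [Finset.card_univ, ← pow_mul] at h1
  have h2 : ∑ e : DirFree H, (∑ a : Fin D, WithLp.ofLp (t a) e ^ 2) ^ (2 * (m + 1)) ≤
      ∑ e : DirFree H, (D : ℝ) ^ (2 * m + 1) * ∑ a : Fin D, WithLp.ofLp (t a) e ^ (4 * (m + 1)) := by
    refine Finset.sum_le_sum fun e _ => ?_
    have h := colourSum_sq_pow_le t e (2 * m + 1)
    rw [show 2 * m + 1 + 1 = 2 * (m + 1) by ring] at h
    refine h.trans (le_of_eq ?_)
    congr 1
    exact Finset.sum_congr rfl fun a _ => by ring_nf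
  rw [← Finset.mul_sum] at h2
  calc _ ≤ (Fintype.card (DirFree H) : ℝ) ^ m * ∑ e : DirFree H, (∑ a : Fin D, WithLp.ofLp (t a) e ^ 2) ^ (2 * (m + 1)) := by
        exact_mod_cast h1
    _ ≤ (Fintype.card (DirFree H) : ℝ) ^ m * ((D : ℝ) ^ (2 * m + 1) * ∑ e : DirFree H, ∑ a : Fin D, WithLp.ofLp (t a) e ^ (4 * (m + 1))) :=
        mul_le_mul_of_nonneg_left h2 (by positivity)
    _ = _ := by ring

end Pointwise

/-! ## §2 Integrability of all powers and the Wick bounds under `γ = gaussD H D` -/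

section Integrals

variable {H D : ℕ}

/-- A finite double sum of even coordinate powers is integrable under `γ`. -/
theorem integrable_sum_sum_coord_pow (n : ℕ) :
    Integrable (fun t : TSpaceD H D => ∑ e : DirFree H, ∑ a : Fin D, WithLp.ofLp (t a) e ^ n) (gaussD H D) :=
  integrable_finsetSum _ fun e _ => integrable_finsetSum _ fun a _ => integrable_coord_pow_gaussD H D (a, e) n

/-- `Q₂` is measurable. -/
theorem measurable_quadDom : Measurable fun t : TSpaceD H D => ∑ e : DirFree H, ∑ a : Fin D, WithLp.ofLp (t a) e ^ 2 :=
  Finset.measurable_sum _ fun e _ => Finset.measurable_sum _ fun a _ => (measurable_coord H D (a, e)).pow_const 2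

/-- `Q₄` is measurable. -/
theorem measurable_quartDom : Measurable fun t : TSpaceD H D => ∑ e : DirFree H, (∑ a : Fin D, WithLp.ofLp (t a) e ^ 2) ^ 2 :=
  Finset.measurable_sum _ fun e _ => (Finset.measurable_sum _ fun a _ => (measurable_coord H D (a, e)).pow_const 2).pow_const 2

/-- **All powers of `Q₂` are integrable** under `γ` (power mean + Gaussian moments). -/
theorem integrable_quadDom_pow (n : ℕ) :
    Integrable (fun t : TSpaceD H D => (∑ e : DirFree H, ∑ a : Fin D, WithLp.ofLp (t a) e ^ 2) ^ n) (gaussD H D) := by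
  rcases n with _ | m
  · simp only [pow_zero]; exact integrable_const _
  refine Integrable.mono' ((integrable_sum_sum_coord_pow (2 * (m + 1))).const_mul (((Fintype.card (DirFree H) : ℝ) * D) ^ m))
    (measurable_quadDom.pow_const _).aestronglyMeasurable (ae_of_all _ fun t => ?_)
  rw [Real.norm_eq_abs, abs_of_nonneg (pow_nonneg (Finset.sum_nonneg fun e _ => Finset.sum_nonneg fun a _ => sq_nonneg _) _)]
  exact quadDom_pow_le t m

/-- **All powers of `Q₄` are integrable** under `γ`. -/
theorem integrable_quartDom_pow (n : ℕ) :
    Integrable (fun t : TSpaceD H D => (∑ e : DirFree H, (∑ a : Fin D, WithLp.ofLp (t a) e ^ 2) ^ 2) ^ n) (gaussD H D) := by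
  rcases n with _ | m
  · simp only [pow_zero]; exact integrable_const _
  refine Integrable.mono' ((integrable_sum_sum_coord_pow (4 * (m + 1))).const_mul
    ((Fintype.card (DirFree H) : ℝ) ^ m * (D : ℝ) ^ (2 * m + 1)))
    (measurable_quartDom.pow_const _).aestronglyMeasurable (ae_of_all _ fun t => ?_)
  rw [Real.norm_eq_abs, abs_of_nonneg (pow_nonneg (Finset.sum_nonneg fun e _ => sq_nonneg _) _)]
  exact quartDom_pow_le t m

/-- **Wick: the mean of `Q₂`** is `≤ D·#E_f·16H` (`H ≥ 1`). -/
theorem integral_quadDom_le (hH : 1 ≤ H) :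
    ∫ t, (∑ e : DirFree H, ∑ a : Fin D, WithLp.ofLp (t a) e ^ 2) ∂(gaussD H D) ≤ (D : ℝ) * (Fintype.card (DirFree H)) * (16 * H) := by
  rw [integral_finsetSum _ fun e _ => integrable_finsetSum _ fun a _ => integrable_coord_pow_gaussD H D (a, e) 2]
  have h : ∀ e : DirFree H, ∫ t, ∑ a : Fin D, WithLp.ofLp (t a) e ^ 2 ∂(gaussD H D) ≤ (D : ℝ) * (16 * H) := by
    intro e
    rw [integral_finsetSum _ fun a _ => integrable_coord_pow_gaussD H D (a, e) 2]
    calc ∑ a : Fin D, ∫ t, WithLp.ofLp (t a) e ^ 2 ∂(gaussD H D) ≤ ∑ _a : Fin D, (16 * (H : ℝ)) :=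
          Finset.sum_le_sum fun a _ => by
            have h1 := integral_coord_pow_even_gaussD_le hH D a e 1
            have h3 : (((2 * 1 - 1).doubleFactorial : ℕ) : ℝ) = 1 := by norm_num [Nat.doubleFactorial]
            rw [h3, one_mul, pow_one, mul_one] at h1
            exact h1
      _ = (D : ℝ) * (16 * H) := by rw [Finset.sum_const, Finset.card_univ, Fintype.card_fin, nsmul_eq_mul]
  calc ∑ e : DirFree H, ∫ t, ∑ a : Fin D, WithLp.ofLp (t a) e ^ 2 ∂(gaussD H D) ≤ ∑ _e : DirFree H, (D : ℝ) * (16 * H) :=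
        Finset.sum_le_sum fun e _ => h e
    _ = _ := by rw [Finset.sum_const, Finset.card_univ, nsmul_eq_mul]; ring

/-- **Wick: the second moment of `Q₂`** is `≤ 3·D²·#E_f²·(16H)²` (`H ≥ 1`). -/
theorem integral_quadDom_sq_le (hH : 1 ≤ H) :
    ∫ t, (∑ e : DirFree H, ∑ a : Fin D, WithLp.ofLp (t a) e ^ 2) ^ 2 ∂(gaussD H D) ≤
      3 * (D : ℝ) ^ 2 * (Fintype.card (DirFree H) : ℝ) ^ 2 * (16 * H) ^ 2 := by
  have hdom := fun t : TSpaceD H D => quadDom_pow_le t 1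
  simp only [pow_one, show 2 * (1 + 1) = 4 from rfl] at hdom
  calc ∫ t, (∑ e : DirFree H, ∑ a : Fin D, WithLp.ofLp (t a) e ^ 2) ^ 2 ∂(gaussD H D)
      ≤ ∫ t, ((Fintype.card (DirFree H) : ℝ) * D) * ∑ e : DirFree H, ∑ a : Fin D, WithLp.ofLp (t a) e ^ 4 ∂(gaussD H D) :=
        integral_mono_of_nonneg (ae_of_all _ fun t => sq_nonneg _) ((integrable_sum_sum_coord_pow 4).const_mul _)
          (ae_of_all _ hdom)
    _ = ((Fintype.card (DirFree H) : ℝ) * D) * ∑ e : DirFree H, ∑ a : Fin D, ∫ t, WithLp.ofLp (t a) e ^ 4 ∂(gaussD H D) := by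
        rw [integral_const_mul, integral_finsetSum _ fun e _ => integrable_finsetSum _ fun a _ =>
          integrable_coord_pow_gaussD H D (a, e) 4]
        exact congrArg (fun x : ℝ => _ * x)
          (Finset.sum_congr rfl fun e _ => integral_finsetSum _ fun a _ => integrable_coord_pow_gaussD H D (a, e) 4)
    _ ≤ ((Fintype.card (DirFree H) : ℝ) * D) * ∑ _e : DirFree H, ∑ _a : Fin D, 3 * (16 * (H : ℝ)) ^ 2 := by
        refine mul_le_mul_of_nonneg_left (Finset.sum_le_sum fun e _ => Finset.sum_le_sum fun a _ => ?_) (by positivity)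
        have h1 := integral_coord_pow_even_gaussD_le hH D a e 2
        have h3 : (((2 * 2 - 1).doubleFactorial : ℕ) : ℝ) = 3 := by norm_num [Nat.doubleFactorial]
        rw [h3] at h1
        exact h1
    _ = _ := by simp only [Finset.sum_const, Finset.card_univ, Fintype.card_fin, nsmul_eq_mul]; ring

/-- **Wick: the mean of `Q₄`** is `≤ 3·D²·#E_f·(16H)²` (`H ≥ 1`). -/
theorem integral_quartDom_le (hH : 1 ≤ H) :
    ∫ t, (∑ e : DirFree H, (∑ a : Fin D, WithLp.ofLp (t a) e ^ 2) ^ 2) ∂(gaussD H D) ≤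
      3 * (D : ℝ) ^ 2 * (Fintype.card (DirFree H) : ℝ) * (16 * H) ^ 2 := by
  have hdom : ∀ t : TSpaceD H D, ∑ e : DirFree H, (∑ a : Fin D, WithLp.ofLp (t a) e ^ 2) ^ 2 ≤
      (D : ℝ) * ∑ e : DirFree H, ∑ a : Fin D, WithLp.ofLp (t a) e ^ 4 := by
    intro t
    rw [Finset.mul_sum]
    refine Finset.sum_le_sum fun e _ => ?_
    have h := colourSum_sq_pow_le t e 1
    simp only [pow_one, show 2 * (1 + 1) = 4 from rfl] at h
    exact h
  calc ∫ t, (∑ e : DirFree H, (∑ a : Fin D, WithLp.ofLp (t a) e ^ 2) ^ 2) ∂(gaussD H D)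
      ≤ ∫ t, (D : ℝ) * ∑ e : DirFree H, ∑ a : Fin D, WithLp.ofLp (t a) e ^ 4 ∂(gaussD H D) :=
        integral_mono_of_nonneg (ae_of_all _ fun t => Finset.sum_nonneg fun e _ => sq_nonneg _)
          ((integrable_sum_sum_coord_pow 4).const_mul _) (ae_of_all _ hdom)
    _ = (D : ℝ) * ∑ e : DirFree H, ∑ a : Fin D, ∫ t, WithLp.ofLp (t a) e ^ 4 ∂(gaussD H D) := by
        rw [integral_const_mul, integral_finsetSum _ fun e _ => integrable_finsetSum _ fun a _ =>
          integrable_coord_pow_gaussD H D (a, e) 4]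
        exact congrArg (fun x : ℝ => _ * x)
          (Finset.sum_congr rfl fun e _ => integral_finsetSum _ fun a _ => integrable_coord_pow_gaussD H D (a, e) 4)
    _ ≤ (D : ℝ) * ∑ _e : DirFree H, ∑ _a : Fin D, 3 * (16 * (H : ℝ)) ^ 2 := by
        refine mul_le_mul_of_nonneg_left (Finset.sum_le_sum fun e _ => Finset.sum_le_sum fun a _ => ?_) (by positivity)
        have h1 := integral_coord_pow_even_gaussD_le hH D a e 2
        have h3 : (((2 * 2 - 1).doubleFactorial : ℕ) : ℝ) = 3 := by norm_num [Nat.doubleFactorial]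
        rw [h3] at h1
        exact h1
    _ = _ := by simp only [Finset.sum_const, Finset.card_univ, Fintype.card_fin, nsmul_eq_mul]; ring

/-- **Wick: the second moment of `Q₄`** is `≤ 105·D⁴·#E_f²·(16H)⁴` (`H ≥ 1`). -/
theorem integral_quartDom_sq_le (hH : 1 ≤ H) :
    ∫ t, (∑ e : DirFree H, (∑ a : Fin D, WithLp.ofLp (t a) e ^ 2) ^ 2) ^ 2 ∂(gaussD H D) ≤
      105 * (D : ℝ) ^ 4 * (Fintype.card (DirFree H) : ℝ) ^ 2 * (16 * H) ^ 4 := by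
  have hdom := fun t : TSpaceD H D => quartDom_pow_le t 1
  simp only [show 2 * 1 + 1 = 3 from rfl, pow_one, show 4 * (1 + 1) = 8 from rfl] at hdom
  calc ∫ t, (∑ e : DirFree H, (∑ a : Fin D, WithLp.ofLp (t a) e ^ 2) ^ 2) ^ 2 ∂(gaussD H D)
      ≤ ∫ t, (Fintype.card (DirFree H) : ℝ) * (D : ℝ) ^ 3 * ∑ e : DirFree H, ∑ a : Fin D, WithLp.ofLp (t a) e ^ 8 ∂(gaussD H D) :=
        integral_mono_of_nonneg (ae_of_all _ fun t => sq_nonneg _) ((integrable_sum_sum_coord_pow 8).const_mul _)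
          (ae_of_all _ hdom)
    _ = (Fintype.card (DirFree H) : ℝ) * (D : ℝ) ^ 3 * ∑ e : DirFree H, ∑ a : Fin D, ∫ t, WithLp.ofLp (t a) e ^ 8 ∂(gaussD H D) := by
        rw [integral_const_mul, integral_finsetSum _ fun e _ => integrable_finsetSum _ fun a _ =>
          integrable_coord_pow_gaussD H D (a, e) 8]
        exact congrArg (fun x : ℝ => _ * x)
          (Finset.sum_congr rfl fun e _ => integral_finsetSum _ fun a _ => integrable_coord_pow_gaussD H D (a, e) 8)
    _ ≤ (Fintype.card (DirFree H) : ℝ) * (D : ℝ) ^ 3 * ∑ _e : DirFree H, ∑ _a : Fin D, 105 * (16 * (H : ℝ)) ^ 4 := by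
        refine mul_le_mul_of_nonneg_left (Finset.sum_le_sum fun e _ => Finset.sum_le_sum fun a _ => ?_) (by positivity)
        have h1 := integral_coord_pow_even_gaussD_le hH D a e 4
        have h3 : (((2 * 4 - 1).doubleFactorial : ℕ) : ℝ) = 105 := by norm_num [Nat.doubleFactorial]
        rw [h3] at h1
        exact h1
    _ = _ := by simp only [Finset.sum_const, Finset.card_univ, Fintype.card_fin, nsmul_eq_mul]; ring

end Integrals

/-! ## §3 The same for the dominators `Σ_e ‖a_e‖²`, `Σ_e ‖a_e‖⁴` (`a_e = unscaleTE H D β t e`, `β > 0`) -/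

section Dominators

variable {H D : ℕ}

/-- All powers of `c·Σ_e ‖a_e‖²` are integrable under `γ` (`β ≥ 0`). -/
theorem integrable_sum_norm_unscaleTE_sq_pow {β : ℝ} (hβ : 0 ≤ β) (c : ℝ) (n : ℕ) :
    Integrable (fun t : TSpaceD H D => (c * ∑ e : ColdFreeIdx H, ‖unscaleTE H D β t e‖ ^ 2) ^ n) (gaussD H D) := by
  simp_rw [sum_norm_unscaleTE_sq hβ, mul_div_assoc', div_eq_inv_mul, mul_pow]
  exact ((integrable_quadDom_pow n).const_mul (c ^ n)).const_mul (β⁻¹ ^ n)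

/-- All powers of `c·Σ_e ‖a_e‖⁴` are integrable under `γ` (`β ≥ 0`). -/
theorem integrable_sum_norm_unscaleTE_pow_four_pow {β : ℝ} (hβ : 0 ≤ β) (c : ℝ) (n : ℕ) :
    Integrable (fun t : TSpaceD H D => (c * ∑ e : ColdFreeIdx H, ‖unscaleTE H D β t e‖ ^ 4) ^ n) (gaussD H D) := by
  simp_rw [sum_norm_unscaleTE_pow_four hβ, mul_div_assoc', div_eq_inv_mul, mul_pow]
  exact ((integrable_quartDom_pow n).const_mul (c ^ n)).const_mul ((β ^ 2)⁻¹ ^ n)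

/-- **Mean of the quadratic dominator**: `∫ Σ_e ‖a_e‖² dγ ≤ D·#E_f·16H/β` (`H ≥ 1`, `β > 0`). -/
theorem integral_sum_norm_unscaleTE_sq_le (hH : 1 ≤ H) {β : ℝ} (hβ : 0 < β) :
    ∫ t, ∑ e : ColdFreeIdx H, ‖unscaleTE H D β t e‖ ^ 2 ∂(gaussD H D) ≤
      (D : ℝ) * (Fintype.card (ColdFreeIdx H)) * (16 * H) / β := by
  simp_rw [sum_norm_unscaleTE_sq hβ.le]
  rw [integral_div, ← card_dirFree_eq_card_coldFreeIdx]
  exact div_le_div_of_nonneg_right (integral_quadDom_le hH) hβ.le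

/-- **Second moment of the quadratic dominator**: `∫ (Σ_e ‖a_e‖²)² dγ ≤ 3·D²·#E_f²·(16H)²/β²` (`H ≥ 1`, `β > 0`). -/
theorem integral_sum_norm_unscaleTE_sq_sq_le (hH : 1 ≤ H) {β : ℝ} (hβ : 0 < β) :
    ∫ t, (∑ e : ColdFreeIdx H, ‖unscaleTE H D β t e‖ ^ 2) ^ 2 ∂(gaussD H D) ≤
      3 * (D : ℝ) ^ 2 * (Fintype.card (ColdFreeIdx H) : ℝ) ^ 2 * (16 * H) ^ 2 / β ^ 2 := by
  simp_rw [sum_norm_unscaleTE_sq hβ.le, div_pow]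
  rw [integral_div, ← card_dirFree_eq_card_coldFreeIdx]
  exact div_le_div_of_nonneg_right (integral_quadDom_sq_le hH) (by positivity)

/-- **Mean of the quartic dominator**: `∫ Σ_e ‖a_e‖⁴ dγ ≤ 3·D²·#E_f·(16H)²/β²` (`H ≥ 1`, `β > 0`). -/
theorem integral_sum_norm_unscaleTE_pow_four_le (hH : 1 ≤ H) {β : ℝ} (hβ : 0 < β) :
    ∫ t, ∑ e : ColdFreeIdx H, ‖unscaleTE H D β t e‖ ^ 4 ∂(gaussD H D) ≤
      3 * (D : ℝ) ^ 2 * (Fintype.card (ColdFreeIdx H)) * (16 * H) ^ 2 / β ^ 2 := by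
  simp_rw [sum_norm_unscaleTE_pow_four hβ.le]
  rw [integral_div, ← card_dirFree_eq_card_coldFreeIdx]
  exact div_le_div_of_nonneg_right (integral_quartDom_le hH) (by positivity)

/-- **Second moment of the quartic dominator**: `∫ (Σ_e ‖a_e‖⁴)² dγ ≤ 105·D⁴·#E_f²·(16H)⁴/β⁴` (`H ≥ 1`, `β > 0`). -/
theorem integral_sum_norm_unscaleTE_pow_four_sq_le (hH : 1 ≤ H) {β : ℝ} (hβ : 0 < β) :
    ∫ t, (∑ e : ColdFreeIdx H, ‖unscaleTE H D β t e‖ ^ 4) ^ 2 ∂(gaussD H D) ≤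
      105 * (D : ℝ) ^ 4 * (Fintype.card (ColdFreeIdx H) : ℝ) ^ 2 * (16 * H) ^ 4 / β ^ 4 := by
  simp_rw [sum_norm_unscaleTE_pow_four hβ.le, div_pow, ← pow_mul]
  rw [integral_div, ← card_dirFree_eq_card_coldFreeIdx]
  exact div_le_div_of_nonneg_right (integral_quartDom_sq_le hH) (by positivity)

/-- **Second moment of the scaled quadratic dominator** `X₃ = c·Σ_e‖a_e‖²`: `∫ X₃² dγ ≤ c²·3D²#E_f²(16H)²/β²`. -/
theorem integral_sq_quadratic_dominator_le (hH : 1 ≤ H) {β : ℝ} (hβ : 0 < β) (c : ℝ) :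
    ∫ t, (c * ∑ e : ColdFreeIdx H, ‖unscaleTE H D β t e‖ ^ 2) ^ 2 ∂(gaussD H D) ≤
      c ^ 2 * (3 * (D : ℝ) ^ 2 * (Fintype.card (ColdFreeIdx H) : ℝ) ^ 2 * (16 * H) ^ 2 / β ^ 2) := by
  have h := integral_sum_norm_unscaleTE_sq_sq_le (D := D) hH hβ
  calc ∫ t, (c * ∑ e : ColdFreeIdx H, ‖unscaleTE H D β t e‖ ^ 2) ^ 2 ∂(gaussD H D)
      = ∫ t, c ^ 2 * (∑ e : ColdFreeIdx H, ‖unscaleTE H D β t e‖ ^ 2) ^ 2 ∂(gaussD H D) :=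
        integral_congr_ae (ae_of_all _ fun t => by ring)
    _ = c ^ 2 * ∫ t, (∑ e : ColdFreeIdx H, ‖unscaleTE H D β t e‖ ^ 2) ^ 2 ∂(gaussD H D) := integral_const_mul _ _
    _ ≤ _ := mul_le_mul_of_nonneg_left h (sq_nonneg c)

/-- **Second moment of the scaled quartic dominator** `X₂ = c·Σ_e‖a_e‖⁴`: `∫ X₂² dγ ≤ c²·105D⁴#E_f²(16H)⁴/β⁴`. -/
theorem integral_sq_quartic_dominator_le (hH : 1 ≤ H) {β : ℝ} (hβ : 0 < β) (c : ℝ) :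
    ∫ t, (c * ∑ e : ColdFreeIdx H, ‖unscaleTE H D β t e‖ ^ 4) ^ 2 ∂(gaussD H D) ≤
      c ^ 2 * (105 * (D : ℝ) ^ 4 * (Fintype.card (ColdFreeIdx H) : ℝ) ^ 2 * (16 * H) ^ 4 / β ^ 4) := by
  have h := integral_sum_norm_unscaleTE_pow_four_sq_le (D := D) hH hβ
  calc ∫ t, (c * ∑ e : ColdFreeIdx H, ‖unscaleTE H D β t e‖ ^ 4) ^ 2 ∂(gaussD H D)
      = ∫ t, c ^ 2 * (∑ e : ColdFreeIdx H, ‖unscaleTE H D β t e‖ ^ 4) ^ 2 ∂(gaussD H D) :=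
        integral_congr_ae (ae_of_all _ fun t => by ring)
    _ = c ^ 2 * ∫ t, (∑ e : ColdFreeIdx H, ‖unscaleTE H D β t e‖ ^ 4) ^ 2 ∂(gaussD H D) := integral_const_mul _ _
    _ ≤ _ := mul_le_mul_of_nonneg_left h (sq_nonneg c)

end Dominators

end Summit.QuantumFields.YangMills.Theorems.AllWindowsColdBoxBoxMidLine

end
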